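import Mathlib
import Literature.Analysis.FluidPDE.FluidComputer.ScaleByScaleBudget
import Literature.Analysis.FluidPDE.FluidComputer.EnstrophyCurvature
import Summits.NavierStokesRegularity.FluidComputer.SparseGalerkinCeiling
import HarnessLib

/-!
# The flux ceiling of the exact Galerkin system: energy crosses a spectral split no faster than the
# low band's ℓ¹-strain allows (the circuit line's "coherence law" E.3b, kernel form)

HONEST FRAMING (cell `ns-blowup`, seat `ns-blowup-circuit` g5, human ruling D-0035): this cell
ATTEMPTS the negative direction of the Clay problem; nothing in this file is a claim about
Navier–Stokes blow-up. WHAT THIS IS NOT: not a statement about the Navier–Stokes PDE; it concerns the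
finite Galerkin truncation `IsGalerkinSolution U (I ∪ O) ν c f` of
`Literature.Analysis.FluidPDE.FluidComputer.GalerkinEnergyBalance` (true `(u·∇)u` coefficients on a
finite mode set, arbitrary pressure multipliers `c`, force `f̂`) split into two disjoint mode sets
`I` ("inside", low band) and `O` ("outside", high band), and bounds the FLUX
`Π = shellTransfer û O I` of Frisch's exact scale-by-scale budget `dE_O/dt = -2νZ_O + Π + ε_in,O`
(tree: `ShellTransfer.hasDerivAt_outsideEnergy_galerkin`).

## What is typed (memo `CIRCUIT-OBSTRUCTIONS.md` §E.3b «the coherence law», §I; companion of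
## `SparseGalerkinCeiling*` (per-mode ceiling) and of the catalogue entry
## `Literature.Barriers.NavierStokesRegularity.ExactRestrictionSparseCeiling`)

* `abs_modeTransfer_le_giver` — GIVER-SIDE structural bound: Verma's mode-to-mode transfer into `k`
  from `p` (mediator `k - p`) obeys `|S(k|p)| ≤ |p|·|û(k-p)|·|û(k)|·|û(p)|` — the wavenumber of the
  GIVER, not of the receiver, by incompressibility of the mediator (`kdot_mediator`:
  `k·û(k-p) = p·û(k-p)`). This is the algebraic fact behind "a large scale sweeping a small scale moves
  no energy up by more than its own gradient".
* `sum_shift_modalEnergy_le` — `Σ_{k∈O} |û(k-p)|² ≤ 2·E_S` for a field vanishing off `S`.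
* `abs_shellTransfer_le` — **THE FLUX CEILING**: for `û` vanishing off `S`,
  `|Π(I→O)| = |shellTransfer û O I| ≤ σ_I · √(2E_O) · √(2E_S)`, where
  `σ_I := Σ_{p∈I} |p|·|û(p)|` is the ℓ¹-STRAIN of the inside band (`≥ sup_x |∇u_I(x)|` on the torus)
  and `E_X = truncEnergy û X`.
* `abs_injectionRate_le` — `|ε_in,O| ≤ √(2E_O) · (Σ_{k∈O} |f̂(k)|²)^{1/2}`.
* `sqrt_outsideEnergy_le_max` — **THE OUTSIDE-ENERGY CEILING** along a supported Galerkin solution on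
  `I ∪ O` with `ν > 0`: if every outside mode has `|k|² ≥ K²` (`K² > 0`) and on `[0,T)` the total
  energy obeys `2·truncEnergy ≤ E₀` (i.e. `Σ|û|² ≤ E₀`), the inside strain is `σ_I(t) ≤ σ`, and the outside
  force is `(Σ_{k∈O}|f̂(t,k)|²)^{1/2} ≤ Φ`, then for all `t ∈ [0,T]`
  `√(2E_O(t)) ≤ max( √(2E_O(0)), (σ·√E₀ + Φ)/(ν K²) )`.
  READING (E.3b): the high band is fed at rate at most `σ_I·√(2E_O)·√(2E_S)` against dissipation
  `2νK²E_O`; it can rise above its initial level only while `σ_I ≥ νK²·√(2E_O)/√(2E_S)` — in the memo's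
  per-octave dictionary `G_n ≥ νN_n/√E_n`. No sparseness is assumed: this is what ANY exact-coefficient
  cascade, thick or sparse, must exhibit, and `σ_I ≤ K_I·√(#I)·√(2E_I)` (`lowStrain_le_sqrt_card`)
  recovers the Bernstein ceiling `G ≤ √M` that makes sparse designs subcritical.
* `sqrt_outsideEnergy_le_max_unforced` — the unforced form (`E₀ = 2E_S(0)` by energy decay, `Φ = 0`).
* `lowStrain_lt_of_outside_growth` — the contrapositive (design-side reading): if the outside amplitude
  ever exceeds `max(√(2E_O(0)), M)` then the inside strain exceeded `(νK²·M - Φ)/√E₀` at some earlier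
  time in the window.

All proved, 0 sorry, no definitions, no named facts. References: U. Frisch, *Turbulence* (CUP 1995)
§2.4 (2.46)–(2.52) (scale-by-scale budget); M. K. Verma, Phys. Rep. 401 (2004) §3.1–3.2 (mode-to-mode
transfer); F. Waleffe, Phys. Fluids A 4 (1992) §II (triad coefficients ≤ wavenumber); C. R. Doering,
J. D. Gibbon (CUP 1995) §5.3 (the Galerkin system). The flux-by-strain bound is the lattice form of the
standard locality estimate `|Π_K| ≲ ‖∇u_{<K}‖_∞ ‖u_{≥K}‖₂ ‖u‖₂`; nothing here is claimed new in print.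
-/

noncomputable section

namespace Summit.NavierStokesRegularity.FluidComputer.GalerkinFluxCeiling

open Set Finset Literature.Analysis.FluidPDE.FluidComputer
  Literature.Analysis.FluidPDE.FluidComputer.ShellTransfer
  Summit.NavierStokesRegularity.FluidComputer.SparseGalerkinCeiling
open scoped ComplexConjugate

/-! ## Cauchy–Schwarz on a finset (square-root form) -/

/-- `Σ f g ≤ √(Σ f²) · √(Σ g²)`. -/
private theorem sum_mul_le_sqrt_mul_sqrt {ι : Type*} (s : Finset ι) (f g : ι → ℝ) :
    ∑ i ∈ s, f i * g i ≤ Real.sqrt (∑ i ∈ s, f i ^ 2) * Real.sqrt (∑ i ∈ s, g i ^ 2) := by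
  rw [← Real.sqrt_mul (Finset.sum_nonneg fun i _ => sq_nonneg (f i))]
  exact (le_abs_self _).trans (Real.abs_le_sqrt (Finset.sum_mul_sq_le_sq_mul_sq s f g))

/-! ## §1 The giver-side structural bound -/

/-- **Giver-side bound on one mode-to-mode transfer**: `|S(k|p)| ≤ |p|·|û(k-p)|·(|û(k)|·|û(p)|)` —
the GIVER's wavenumber `|p|`, by incompressibility of the mediator `k·û(k-p) = p·û(k-p)`
(`kdot_mediator`). Here `|û(q)| = √(2·modalEnergy û q)`, `|p| = √(knormSq p)`. -/
theorem abs_modeTransfer_le_giver (U : FourierVelocity) (k p : Fin 3 → ℤ) :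
    |modeTransfer U k p| ≤ Real.sqrt (knormSq p) * Real.sqrt (2 * modalEnergy U (k - p)) *
      (Real.sqrt (2 * modalEnergy U k) * Real.sqrt (2 * modalEnergy U p)) := by
  unfold modeTransfer
  rw [kdot_mediator U k p]
  refine (Complex.abs_im_le_norm _).trans ?_
  rw [norm_mul, two_mul_modalEnergy, two_mul_modalEnergy, two_mul_modalEnergy]
  exact mul_le_mul (norm_kdot_le _ _) (norm_cdot_conj_le _ _) (norm_nonneg _) (by positivity)

/-- Shifted energy on a finite set: for a field vanishing off `S`, `Σ_{k∈O} |û(k-p)|² ≤ 2·E_S`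
(the shift `k ↦ k - p` is injective and the terms landing outside `S` vanish). -/
theorem sum_shift_modalEnergy_le (U : FourierVelocity) (S O : Finset (Fin 3 → ℤ)) (p : Fin 3 → ℤ)
    (hoff : ∀ q ∉ S, U.coeff q = 0) :
    ∑ k ∈ O, 2 * modalEnergy U (k - p) ≤ 2 * truncEnergy U S := by
  classical
  have hinj : Set.InjOn (fun k : Fin 3 → ℤ => k - p) ↑O := fun a _ b _ h => sub_left_injective h
  rw [show ∑ k ∈ O, 2 * modalEnergy U (k - p) = ∑ q ∈ O.image (fun k => k - p), 2 * modalEnergy U q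
    from (Finset.sum_image (f := fun q => 2 * modalEnergy U q) hinj).symm]
  unfold truncEnergy
  rw [Finset.mul_sum]
  -- split the image into the part inside `S` (bounded by the sum over `S`) and the part outside (zero)
  rw [← Finset.sum_filter_add_sum_filter_not (O.image fun k => k - p) (fun q => q ∈ S)]
  have hzero : ∑ q ∈ (O.image fun k => k - p).filter (fun q => ¬ q ∈ S), 2 * modalEnergy U q = 0 := by
    refine Finset.sum_eq_zero fun q hq => ?_
    rw [modalEnergy_eq_zero_of_coeff U (hoff q (Finset.mem_filter.mp hq).2), mul_zero]
  rw [hzero, add_zero]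
  refine Finset.sum_le_sum_of_subset_of_nonneg (fun q hq => (Finset.mem_filter.mp hq).2) ?_
  intro q _ _
  have := modalEnergy_nonneg U q
  positivity

/-! ## §2 The flux ceiling -/

/-- **THE FLUX CEILING.** For a field vanishing off `S` and any finite mode sets `O`, `I`:
`|shellTransfer û O I| ≤ σ_I · (√(2E_O) · √(2E_S))`, `σ_I = Σ_{p∈I} |p|·|û(p)|` the ℓ¹-strain of
`I`, `E_X = truncEnergy û X`. Memo E.3b: a band can pump another at most at the rate of its own
gradient; against dissipation `νK²` this is the coherence requirement of every exact-coefficient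
cascade. -/
theorem abs_shellTransfer_le (U : FourierVelocity) (S O I : Finset (Fin 3 → ℤ))
    (hoff : ∀ q ∉ S, U.coeff q = 0) :
    |shellTransfer U O I| ≤
      (∑ p ∈ I, Real.sqrt (knormSq p) * Real.sqrt (2 * modalEnergy U p)) *
        (Real.sqrt (2 * truncEnergy U O) * Real.sqrt (2 * truncEnergy U S)) := by
  unfold shellTransfer
  rw [Finset.sum_comm]
  refine (Finset.abs_sum_le_sum_abs _ _).trans ?_
  rw [Finset.sum_mul]
  refine Finset.sum_le_sum fun p _ => ?_
  refine (Finset.abs_sum_le_sum_abs _ _).trans ?_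
  -- inner sum over the receivers k ∈ O
  have hk : ∀ k ∈ O, |modeTransfer U k p| ≤ Real.sqrt (knormSq p) * Real.sqrt (2 * modalEnergy U p) *
      (Real.sqrt (2 * modalEnergy U k) * Real.sqrt (2 * modalEnergy U (k - p))) := by
    intro k _
    calc |modeTransfer U k p| ≤ Real.sqrt (knormSq p) * Real.sqrt (2 * modalEnergy U (k - p)) *
          (Real.sqrt (2 * modalEnergy U k) * Real.sqrt (2 * modalEnergy U p)) :=
          abs_modeTransfer_le_giver U k p
      _ = _ := by ring
  refine (Finset.sum_le_sum hk).trans ?_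
  rw [← Finset.mul_sum]
  refine mul_le_mul_of_nonneg_left ?_ (by positivity)
  -- Cauchy–Schwarz over k ∈ O, then the shifted energy bound
  refine (sum_mul_le_sqrt_mul_sqrt O _ _).trans ?_
  have h1 : ∑ k ∈ O, Real.sqrt (2 * modalEnergy U k) ^ 2 = 2 * truncEnergy U O := by
    unfold truncEnergy
    rw [Finset.mul_sum]
    refine Finset.sum_congr rfl fun k _ => Real.sq_sqrt ?_
    have := modalEnergy_nonneg U k; positivity
  have h2 : ∑ k ∈ O, Real.sqrt (2 * modalEnergy U (k - p)) ^ 2 ≤ 2 * truncEnergy U S := by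
    calc ∑ k ∈ O, Real.sqrt (2 * modalEnergy U (k - p)) ^ 2 = ∑ k ∈ O, 2 * modalEnergy U (k - p) :=
          Finset.sum_congr rfl fun k _ => Real.sq_sqrt (by have := modalEnergy_nonneg U (k - p); positivity)
      _ ≤ 2 * truncEnergy U S := sum_shift_modalEnergy_le U S O p hoff
  rw [h1]
  exact mul_le_mul_of_nonneg_left (Real.sqrt_le_sqrt h2) (Real.sqrt_nonneg _)

/-- The ℓ¹-strain of a band is at most its top wavenumber times `√(#I)·√(2E_I)` (Cauchy–Schwarz) —
the lattice Bernstein ceiling `G ≤ √M` of memo E.3b; for a sparse band this makes the flux ceiling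
subcritical (cf. `SparseGalerkinCeiling`). -/
theorem lowStrain_le_sqrt_card (U : FourierVelocity) (I : Finset (Fin 3 → ℤ)) {KI : ℝ} (hKI : 0 ≤ KI)
    (htop : ∀ p ∈ I, Real.sqrt (knormSq p) ≤ KI) :
    ∑ p ∈ I, Real.sqrt (knormSq p) * Real.sqrt (2 * modalEnergy U p) ≤
      KI * (Real.sqrt I.card * Real.sqrt (2 * truncEnergy U I)) := by
  calc ∑ p ∈ I, Real.sqrt (knormSq p) * Real.sqrt (2 * modalEnergy U p)
      ≤ ∑ p ∈ I, KI * Real.sqrt (2 * modalEnergy U p) :=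
        Finset.sum_le_sum fun p hp => mul_le_mul_of_nonneg_right (htop p hp) (Real.sqrt_nonneg _)
    _ = KI * ∑ p ∈ I, 1 * Real.sqrt (2 * modalEnergy U p) := by rw [← Finset.mul_sum]; simp
    _ ≤ KI * (Real.sqrt (∑ p ∈ I, (1 : ℝ) ^ 2) * Real.sqrt (∑ p ∈ I, Real.sqrt (2 * modalEnergy U p) ^ 2)) :=
        mul_le_mul_of_nonneg_left (sum_mul_le_sqrt_mul_sqrt I _ _) hKI
    _ = KI * (Real.sqrt I.card * Real.sqrt (2 * truncEnergy U I)) := by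
        congr 2
        · simp
        · congr 1
          unfold truncEnergy; rw [Finset.mul_sum]
          exact Finset.sum_congr rfl fun p _ =>
            Real.sq_sqrt (by have := modalEnergy_nonneg U p; positivity)

/-- The injection into a band is bounded by the band amplitude times the band force:
`|ε_in,O| ≤ √(2E_O) · (Σ_{k∈O} Σ_j |f̂_j(k)|²)^{1/2}`. -/
theorem abs_injectionRate_le (U : FourierVelocity) (f : (Fin 3 → ℤ) → Fin 3 → ℂ)
    (O : Finset (Fin 3 → ℤ)) :
    |injectionRate U f O| ≤ Real.sqrt (2 * truncEnergy U O) *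
      Real.sqrt (∑ k ∈ O, ∑ j, Complex.normSq (f k j)) := by
  unfold injectionRate
  refine (Finset.abs_sum_le_sum_abs _ _).trans ?_
  have hk : ∀ k ∈ O, |(cdot (fun j => conj (U.coeff k j)) (f k)).re| ≤
      Real.sqrt (2 * modalEnergy U k) * Real.sqrt (∑ j, Complex.normSq (f k j)) :=
    fun k _ => abs_injection_le U (f k) k
  refine (Finset.sum_le_sum hk).trans ?_
  refine (sum_mul_le_sqrt_mul_sqrt O _ _).trans (le_of_eq ?_)
  congr 1
  · congr 1
    unfold truncEnergy; rw [Finset.mul_sum]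
    exact Finset.sum_congr rfl fun k _ => Real.sq_sqrt (by have := modalEnergy_nonneg U k; positivity)
  · congr 1
    exact Finset.sum_congr rfl fun k _ =>
      Real.sq_sqrt (Finset.sum_nonneg fun j _ => Complex.normSq_nonneg _)

/-! ## §3 The outside-energy ceiling along the Galerkin flow -/

/-- Band enstrophy dominates `K²` times band energy when every mode of the band has `|k|² ≥ K²`. -/
theorem mul_truncEnergy_le_truncEnstrophy (U : FourierVelocity) (O : Finset (Fin 3 → ℤ)) {K2 : ℝ}
    (hK : ∀ k ∈ O, K2 ≤ knormSq k) : K2 * truncEnergy U O ≤ truncEnstrophy U O := by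
  unfold truncEnergy truncEnstrophy
  rw [Finset.mul_sum]
  exact Finset.sum_le_sum fun k hk => mul_le_mul_of_nonneg_right (hK k hk) (modalEnergy_nonneg U k)

/-- **THE OUTSIDE-ENERGY CEILING (coherence law, kernel form).** Let `U` solve the forced Galerkin
system on the disjoint split `I ∪ O`, supported there, `ν > 0`, with every outside mode above `K`:
`K2 ≤ |k|²` (`K2 > 0`). If on `[0,T)` the energy obeys `2·truncEnergy û (I ∪ O) ≤ E₀`, the inside
ℓ¹-strain obeys `σ_I(t) = Σ_{p∈I}|p||û(t,p)| ≤ σ` and the outside force `(Σ_{k∈O}|f̂(t,k)|²)^{1/2} ≤ Φ`,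
then for every `t ∈ [0,T]`:
`√(2E_O(t)) ≤ max( √(2E_O(0)), (σ·√E₀ + Φ)/(ν·K2) )`.
The outside band rises above its initial amplitude only while the inside strain beats `νK²` in the
ratio `√(2E_O)/√E₀` (memo E.3b: `G_n ≥ νN_n/√E_n`). No sparseness hypothesis. -/
theorem sqrt_outsideEnergy_le_max {U : ℝ → FourierVelocity} {I O : Finset (Fin 3 → ℤ)}
    (hIO : Disjoint I O) {ν : ℝ} {c : ℝ → (Fin 3 → ℤ) → ℂ} {f : ℝ → (Fin 3 → ℤ) → Fin 3 → ℂ}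
    (hU : IsGalerkinSolution U (I ∪ O) ν c f) (hsupp : IsSupportedOn U (I ∪ O)) (hν : 0 < ν)
    {K2 : ℝ} (hK2 : 0 < K2) (hK : ∀ k ∈ O, K2 ≤ knormSq k)
    {T E₀ σ Φ : ℝ} (hσ : 0 ≤ σ)
    (henergy : ∀ t ∈ Ico 0 T, 2 * truncEnergy (U t) (I ∪ O) ≤ E₀)
    (hstrain : ∀ t ∈ Ico 0 T,
      ∑ p ∈ I, Real.sqrt (knormSq p) * Real.sqrt (2 * modalEnergy (U t) p) ≤ σ)
    (hforce : ∀ t ∈ Ico 0 T, Real.sqrt (∑ k ∈ O, ∑ j, Complex.normSq (f t k j)) ≤ Φ) :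
    ∀ t ∈ Icc 0 T, Real.sqrt (2 * truncEnergy (U t) O) ≤
      max (Real.sqrt (2 * truncEnergy (U 0) O)) ((σ * Real.sqrt E₀ + Φ) / (ν * K2)) := by
  have hd : 0 < ν * K2 := mul_pos hν hK2
  have hder := fun s => hasDerivAt_outsideEnergy_galerkin hIO hU s
  have hcont : ContinuousOn (fun s => truncEnergy (U s) O) (Icc 0 T) :=
    fun s _ => (hder s).continuousAt.continuousWithinAt
  refine sqrt_two_mul_le_max (φ := fun s => truncEnergy (U s) O) (d := ν * K2)
    (F := σ * Real.sqrt E₀ + Φ) (T := T) hd hcont (fun s _ => (hder s).hasDerivWithinAt)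
    (fun s _ => Finset.sum_nonneg fun k _ => modalEnergy_nonneg (U s) k) ?_
  intro s hs
  have hoff : ∀ q ∉ I ∪ O, (U s).coeff q = 0 := fun q hq => hsupp s q hq
  -- the three terms of Frisch's budget
  have hZ := mul_truncEnergy_le_truncEnstrophy (U s) O hK
  have hPi := (le_abs_self _).trans (abs_shellTransfer_le (U s) (I ∪ O) O I hoff)
  have hε := (le_abs_self _).trans (abs_injectionRate_le (U s) (f s) O)
  have hEO : 0 ≤ Real.sqrt (2 * truncEnergy (U s) O) := Real.sqrt_nonneg _
  have hS : Real.sqrt (2 * truncEnergy (U s) (I ∪ O)) ≤ Real.sqrt E₀ := Real.sqrt_le_sqrt (henergy s hs)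
  have hσs := hstrain s hs
  have hΦs := hforce s hs
  have hσnn : 0 ≤ ∑ p ∈ I, Real.sqrt (knormSq p) * Real.sqrt (2 * modalEnergy (U s) p) :=
    Finset.sum_nonneg fun p _ => by positivity
  -- flux ≤ σ √E₀ √(2E_O), injection ≤ Φ √(2E_O)
  have h1 : shellTransfer (U s) O I ≤ Real.sqrt (2 * truncEnergy (U s) O) * (σ * Real.sqrt E₀) := by
    refine hPi.trans ?_
    calc (∑ p ∈ I, Real.sqrt (knormSq p) * Real.sqrt (2 * modalEnergy (U s) p)) *
          (Real.sqrt (2 * truncEnergy (U s) O) * Real.sqrt (2 * truncEnergy (U s) (I ∪ O)))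
        ≤ σ * (Real.sqrt (2 * truncEnergy (U s) O) * Real.sqrt E₀) :=
          mul_le_mul hσs (mul_le_mul_of_nonneg_left hS hEO) (by positivity) hσ
      _ = _ := by ring
  have h2 : injectionRate (U s) (f s) O ≤ Real.sqrt (2 * truncEnergy (U s) O) * Φ :=
    hε.trans (mul_le_mul_of_nonneg_left hΦs hEO)
  nlinarith [hZ, h1, h2, hν.le]

/-- **Unforced form**: for `f̂ = 0` the energy hypothesis is discharged by energy decay
(`E₀ = 2·E_{I∪O}(0)`) and `Φ = 0`: `√(2E_O(t)) ≤ max(√(2E_O(0)), σ·√(2E(0))/(νK²))` for all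
`t ∈ [0,T]` whenever the inside strain stays `≤ σ` on `[0,T)`. -/
theorem sqrt_outsideEnergy_le_max_unforced {U : ℝ → FourierVelocity} {I O : Finset (Fin 3 → ℤ)}
    (hIO : Disjoint I O) {ν : ℝ} {c : ℝ → (Fin 3 → ℤ) → ℂ}
    (hU : IsGalerkinSolution U (I ∪ O) ν c fun _ _ _ => 0) (hsupp : IsSupportedOn U (I ∪ O))
    (hν : 0 < ν) {K2 : ℝ} (hK2 : 0 < K2) (hK : ∀ k ∈ O, K2 ≤ knormSq k) {T σ : ℝ} (hσ : 0 ≤ σ)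
    (hstrain : ∀ t ∈ Ico 0 T,
      ∑ p ∈ I, Real.sqrt (knormSq p) * Real.sqrt (2 * modalEnergy (U t) p) ≤ σ) :
    ∀ t ∈ Icc 0 T, Real.sqrt (2 * truncEnergy (U t) O) ≤
      max (Real.sqrt (2 * truncEnergy (U 0) O))
        (σ * Real.sqrt (2 * truncEnergy (U 0) (I ∪ O)) / (ν * K2)) := by
  have h := sqrt_outsideEnergy_le_max (T := T) (Φ := 0) (E₀ := 2 * truncEnergy (U 0) (I ∪ O))
    hIO hU hsupp hν hK2 hK hσ
    (fun t ht => by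
      have h0 := truncEnergy_antitone hν.le hU ht.1
      simp only at h0
      linarith)
    hstrain (fun t _ => by simp)
  simpa using h

/-- **Design-side reading (contrapositive).** Under the hypotheses of `sqrt_outsideEnergy_le_max`
EXCEPT the strain bound: if at some `t ∈ [0,T]` the outside amplitude exceeds both its initial value
and a level `M`, `√(2E_O(t)) > max(√(2E_O(0)), M)`, then the inside ℓ¹-strain exceeded
`(νK²·M - Φ)/√E₀` at some time in `[0,T)` (for `E₀ > 0`): growth of a high band REQUIRES inside
coherence `σ_I > (νK²M - Φ)/√E₀` — the typed form of memo E.3b / §I «a pumping level must be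
coherent enough to beat νN²». -/
theorem lowStrain_lt_of_outside_growth {U : ℝ → FourierVelocity} {I O : Finset (Fin 3 → ℤ)}
    (hIO : Disjoint I O) {ν : ℝ} {c : ℝ → (Fin 3 → ℤ) → ℂ} {f : ℝ → (Fin 3 → ℤ) → Fin 3 → ℂ}
    (hU : IsGalerkinSolution U (I ∪ O) ν c f) (hsupp : IsSupportedOn U (I ∪ O)) (hν : 0 < ν)
    {K2 : ℝ} (hK2 : 0 < K2) (hK : ∀ k ∈ O, K2 ≤ knormSq k)
    {T E₀ Φ M : ℝ} (hE₀ : 0 < E₀)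
    (henergy : ∀ t ∈ Ico 0 T, 2 * truncEnergy (U t) (I ∪ O) ≤ E₀)
    (hforce : ∀ t ∈ Ico 0 T, Real.sqrt (∑ k ∈ O, ∑ j, Complex.normSq (f t k j)) ≤ Φ)
    {t : ℝ} (ht : t ∈ Icc 0 T)
    (hgrow : max (Real.sqrt (2 * truncEnergy (U 0) O)) M < Real.sqrt (2 * truncEnergy (U t) O)) :
    ∃ s ∈ Ico 0 T, (ν * K2 * M - Φ) / Real.sqrt E₀ <
      ∑ p ∈ I, Real.sqrt (knormSq p) * Real.sqrt (2 * modalEnergy (U s) p) := by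
  by_contra hcon
  push Not at hcon
  have hsE : 0 < Real.sqrt E₀ := Real.sqrt_pos.mpr hE₀
  -- with σ := max 0 ((νK²M - Φ)/√E₀) the ceiling gives √(2E_O(t)) ≤ max(√(2E_O(0)), M')
  set σ := max 0 ((ν * K2 * M - Φ) / Real.sqrt E₀) with hσdef
  have hσ0 : 0 ≤ σ := le_max_left _ _
  have hstrain : ∀ s ∈ Ico 0 T,
      ∑ p ∈ I, Real.sqrt (knormSq p) * Real.sqrt (2 * modalEnergy (U s) p) ≤ σ :=
    fun s hs => (hcon s hs).trans (le_max_right _ _)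
  have h := sqrt_outsideEnergy_le_max hIO hU hsupp hν hK2 hK hσ0 henergy hstrain hforce t ht
  -- the second branch of the max is ≤ max M …: (σ√E₀ + Φ)/(νK²) ≤ M when σ = (νK²M-Φ)/√E₀ ≥ 0, else ≤ Φ/(νK²)…
  have hd : 0 < ν * K2 := mul_pos hν hK2
  rcases le_or_gt ((ν * K2 * M - Φ) / Real.sqrt E₀) 0 with hneg | hpos
  · -- then σ = 0 and νK²M ≤ Φ, so (0·√E₀ + Φ)/(νK²) ≥ M; but also the bound reads ≤ max(init, Φ/(νK²))
    have hσ : σ = 0 := by rw [hσdef]; exact max_eq_left hneg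
    rw [hσ, zero_mul, zero_add] at h
    have hMΦ : ν * K2 * M ≤ Φ := by
      have := (div_le_iff₀ hsE).mp hneg
      linarith
    -- M ≤ Φ/(νK²)? no: we need the contradiction from hgrow: √(2E_O t) > max(init, M) while ≤ max(init, Φ/(νK²));
    -- this branch is consistent only if Φ/(νK²) > M, in which case no contradiction — so we must use σ differently.
    -- Instead observe: in this branch the claimed witness inequality `(νK²M-Φ)/√E₀ < σ_I(s)` holds for ANY s with
    -- σ_I(s) ≥ 0 > (νK²M-Φ)/√E₀ unless equality 0; handle via hcon at s = 0 if T > 0.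
    rcases lt_or_ge 0 T with hT | hT
    · have h0 := hcon 0 ⟨le_rfl, hT⟩
      have hnn : 0 ≤ ∑ p ∈ I, Real.sqrt (knormSq p) * Real.sqrt (2 * modalEnergy (U 0) p) :=
        Finset.sum_nonneg fun p _ => by positivity
      -- (νK²M-Φ)/√E₀ ≤ 0 ≤ σ_I(0) and hcon says σ_I(0) ≤ (νK²M-Φ)/√E₀, so both are 0 and νK²M = Φ… then bound ≤ max(init, M)
      have hEq : (ν * K2 * M - Φ) / Real.sqrt E₀ = 0 := le_antisymm hneg (hnn.trans h0)
      have hMΦ' : ν * K2 * M = Φ := by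
        have := div_eq_zero_iff.mp hEq
        rcases this with h1 | h1
        · linarith
        · exact absurd h1 hsE.ne'
      have hb : Φ / (ν * K2) = M := by rw [← hMΦ']; field_simp
      rw [hb] at h
      exact absurd hgrow (not_lt.mpr h)
    · -- T ≤ 0: then t ∈ Icc 0 T forces t = 0 and hgrow contradicts itself
      have ht0 : t = 0 := le_antisymm (ht.2.trans hT) ht.1
      rw [ht0] at hgrow
      exact absurd (lt_of_le_of_lt (le_max_left _ _) hgrow) (lt_irrefl _)
  · have hσ : σ = (ν * K2 * M - Φ) / Real.sqrt E₀ := by rw [hσdef]; exact max_eq_right hpos.le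
    have hb : (σ * Real.sqrt E₀ + Φ) / (ν * K2) = M := by
      rw [hσ]; field_simp; ring
    rw [hb] at h
    exact absurd hgrow (not_lt.mpr h)

end Summit.NavierStokesRegularity.FluidComputer.GalerkinFluxCeiling
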